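import Literature.Claims.NS.ClayVariants
import HarnessLib

/-!
# Claim skeleton C49 — Muriel 2010, «An Exact Solution of the 3-D Navier-Stokes Equation»

**Cite header.** Amador Muriel, *An Exact Solution of the 3-D Navier-Stokes Equation*, arXiv:1011.6630
[math-ph] **v1** (30 Nov 2010; ONLY version; PDF-only e-print, 64 pp., Maple 13 worksheets; no
journal version of record), bib key `Muriel2010`; `p.` = PDF page = printed page, `(n)` = the paper's
equation numbers; sources `pub/ns-claims/sources/Muriel2010/` (text of pp.7–9, 14 and the long
displays (6), (9)–(14), (17) are Maple worksheet IMAGES — not re-typed, compute 0). UNREFEREED CLAIM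
under adjudication (D-0090 NS-claims sweep, cell `ns-claims`, row C49; tier 3 «SOL» row) — this file
TYPES the claimed statement and the text's own intermediate assertions as `Prop`s and asserts none
of them; the theorems are compositions by pure logic and plumbing about this file's own definitions.
Nothing here is a theorem about Navier–Stokes. [cite: Muriel2010, abstract p.1; §1 p.2; §9 pp.31–32]

**Claimed statement (verbatim, abstract p.1).** «An improved operator formalism … is used for uniform
initial data. We then choose a Gaussian pair potential between particles. With these two conditions,
the velocity fields, energy and pressure are calculated exactly. All stipulations of the Clay
Mathematics Institute for proposed solutions of the 3-D Navier-Stokes Equation are satisfied by our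
time evolution equation solution. We then substitute the results for the velocity fields into the 3-d
Navier-Stokes Equation and calculate the pressure. The results from our time evolution equation and
the prescribed pressure from the Navier-Stokes Equation constitute an exact solution to the
Navier-Stokes Equation.» §1 p.2: «The purpose of this Report is to fully document a procedure for
arriving at an exact solution of this well-known problem. The Report is written to satisfy the
requirements of the Clay Institute of Mathematics». §9 p.37: «We thus suggest that the velocity field
solutions from our time evolution equation, and the prescription of NSE for the pressure solves the
3-D Navier-Stokes Equation in a self-consistent way. The solutions are smooth, and there is no blowup
time for the energy.» Typed as `ClaimedTheorem`: an ∃-statement — ONE datum (the uniform jet (4),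
`jetDatum`), ONE velocity field, and for each viscosity a pressure given by the recipe (16)–(17).

**Clay delta (reference `Literature.Claims.NS.ClayVariants`).** Nearest statement (A)
`clayR3.Regularity`. Δ6/Δ7 FORM/QUANTIFIERS: «∃ datum ∃ solution» vs (A) «∀ datum ∃ solution» (and
(C)/(D) are NON-existence statements) — an exact solution for one datum bears on none of (A)–(D).
Δ4 DATA: the datum (4) p.3, «uniform initial data … ϕ(p) = δ(pₓ − p₀)δ(p_y)δ(p_z) … a one-dimensional
jet satisfying an initial condition stipulated by the Clay Institute», is the spatially CONSTANT field
`u⁰ ≡ (p₀/m) eₓ`: not rapidly decaying (4) and of infinite energy (7) unless `p₀ = 0`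
(`jetDatum_not_clayData`). Δ2 EQUATIONS: the velocity field is produced by a kinetic «time evolution
equation» (1)–(3) pp.2–3, independent of `ν` (§11 p.37 «Viscosity is an adjustable parameter in NSE,
but in our TE solutions, it does not show up»), and NSE enters only as the DEFINITION of `∇P`
((16)–(17) pp.31–32). Δ1 DOMAIN: pair potential integrated «over a cube of dimension L» (p.3), plots in
a cube / «3-d toroid geometry» (p.13) — the typed statement is on `ℝ³` as the abstract's «3-D
Navier-Stokes Equation». The printed bridge «all stipulations of the Clay Mathematics Institute … are
satisfied» is `Step_4_bridge`; `clay_of_bridge` is its trivial use; no `clay_of_claimed`.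

**Architecture and ORDERED STEP INDEX** (print order):
* Step 1 = `Step_1_teField` — §2–§4 pp.2–12, (1)–(3), (7)–(12): the time-evolution (TE) formula for
  the one-particle distribution with uniform initial data (4) and Gaussian pair potential (5) yields
  explicit momentum fields `xmom, ymom, zmom` (u = p/m), «analytic … and do not blow up in time»
  (p.12). The displayed fields (12)/(11) are Maple images; typed as the EXISTENCE of a smooth field on
  `ℝ³ × [0,∞)` with the jet datum (what the later steps consume).
* Step 2 = `Step_2_divFree` — §8 (15) pp.29–30: «One requirement of the Clay problem definition is that
  u = p/m must satisfy ∇ᵢuᵢ = 0 … we generated instead Fig. 14, showing that in fact, for most of the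
  volume of the cube, the divergence is zero. At the boundaries, the condition no longer holds.» —
  typed as the property the composition needs (div-free slices for `t ≥ 0`) OF the Step-1 field.
* Step 3 = `Step_3_pressure` — §9 (16)–(17) pp.31–32 (+ p.36): «∂P/∂x = ν∇²uₓ − uᵢ∇ᵢuₓ − ∂uₓ/∂t (16) …
  what we now do is evaluate the right-hand side of NSE in Eq. (16) and find the gradient of the
  pressure … (17) which is simply NSE written in a form that reflects the above-mentioned philosophical
  shift»: for the TE field and each `ν`, the recipe DEFINES a pressure, i.e. the NS residual
  `νΔu − (u·∇)u − ∂ₜu` is a gradient. Its ABSTRACT GRAIN (HYGIENE 13) `Step_3Abs`: the recipe works for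
  velocity fields in general («we have all expressions for the velocities», p.31).
* Step 4 = `Step_4_bridge` — abstract p.1 l.13–15, §1 p.2 l.3–5, §8 p.30 l.4–7 («The self-consistent
  non-linear solutions all satisfy the Clay stipulations, continuous fields and no blowup times»): the
  exhibited solution settles the Clay problem — typed as `ClaimedTheorem → clayR3.Regularity`.
COMPOSITION: `claim_of_steps : Step_123 → ClaimedTheorem` PROVED (Steps 1–3 are properties of ONE
field, so they are typed jointly as the ∃-package `Step_123`; the momentum equation (1) is the recipe
(17) rearranged); `clay_of_bridge : Step_4_bridge → ClaimedTheorem → clayR3.Regularity` (trivial).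
Kernel notes for the refuter/referee: `ClaimedTheorem` and `Step_123` are inhabited by the constant
flow `u ≡ (p₀/m)eₓ, P ≡ 0` (to be landed by salvage, not here) — the row's distance to Clay is the
STATEMENT (Δ6/Δ7, Δ4); `Step_3Abs` is kernel-refutable (e.g. `u(t,x) = t·(x₂,0,0)`: residual
`(−x₂,0,0)`, not a gradient).

WHAT THIS IS NOT: not a claim about NS regularity or blow-up; not a claim about any author beyond the
typed locator.
-/

open Set Laplacian
open Literature.Analysis.FluidPDE Literature.Claims.NS.ClayVariants
open scoped ContDiff

namespace Literature.Claims.NS.Muriel2010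

noncomputable section

/-- Physical space `ℝ³`. [folklore] -/
abbrev R3 : Type := EuclideanSpace ℝ (Fin 3)

/-- The printed initial condition (4) p.3: uniform density (`n₀ = 1`) and momentum distribution
`ϕ(p) = δ(pₓ − p₀)δ(p_y)δ(p_z)` — every particle has momentum `p₀ eₓ`, so the initial velocity field
`u = p/m` is the CONSTANT field `(p₀/m) eₓ` («a one-dimensional jet satisfying an initial condition
stipulated by the Clay Institute»). [cite: Muriel2010, (4) p.3] -/
def jetDatum (p₀ m : ℝ) : R3 → R3 :=
  fun _ => (p₀ / m) • EuclideanSpace.single 0 1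

/-- The right-hand side of (16) p.31, `ν∇²u − (u·∇)u − ∂u/∂t`, for a time-dependent field on
`ℝ³ × [0,∞)` (time derivative within `[0,∞)`, as in the tree's `IsNavierStokesSolution`).
[cite: Muriel2010, (16) p.31] -/
def residual (ν : ℝ) (u : ℝ → R3 → R3) (t : ℝ) (x : R3) : R3 :=
  ν • (Δ (u t)) x - fderiv ℝ (u t) x (u t x) - derivWithin (fun s => u s x) (Ici 0) t

/-- The PRESSURE RECIPE (16)–(17) pp.31–32: `P` is a pressure for `u` at viscosity `ν` when its spatial
gradient equals the NS residual at every `t ≥ 0`, `x` («we solve for the gradient of the pressure …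
from NSE: (17)»). [cite: Muriel2010, (16)–(17) pp.31–32] -/
def PressureRecipe (ν : ℝ) (u : ℝ → R3 → R3) (P : ℝ → R3 → ℝ) : Prop :=
  ∀ t : ℝ, 0 ≤ t → ∀ x : R3, gradient (P t) x = residual ν u t x

/-! ## The claimed statement -/

/-- **The claimed theorem (as printed, abstract p.1 + §9 p.37)**: there are jet parameters `p₀, m`
(`m ≠ 0`) and a velocity field `u`, smooth on `ℝ³ × [0,∞)` («The solutions are smooth, and there is no
blowup time»), with `u(·,0)` the uniform jet (4) and divergence-free slices ((15), «All stipulations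
of the Clay Mathematics Institute …»), such that for every viscosity `ν > 0` the pressure prescribed by
NSE ((16)–(17)) makes `(u, P)` an exact smooth solution of the 3-D Navier–Stokes system with `f ≡ 0`.
An ∃-statement about ONE datum. [cite: Muriel2010, abstract p.1; §8 p.30; §9 pp.31–32 and p.37] -/
def ClaimedTheorem : Prop :=
  ∃ (p₀ m : ℝ) (u : ℝ → R3 → R3), m ≠ 0 ∧ IsSmoothOnHalfSpace u ∧ u 0 = jetDatum p₀ m ∧
    (∀ t : ℝ, 0 ≤ t → NSWave0.IsDivFree (u t)) ∧
    ∀ ν : ℝ, 0 < ν → ∃ P : ℝ → R3 → ℝ, IsSmoothOnHalfSpace P ∧ PressureRecipe ν u P ∧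
      IsNavierStokesSolution ν 0 (jetDatum p₀ m) u P

/-! ## The steps (none asserted) -/

/-- **Steps 1–3 as the paper uses them — properties of ONE field, typed jointly.**
Step 1 (§2–§4 pp.2–12, (1)–(12)): the TE construction gives a velocity field `u = p/m`, smooth on
`ℝ³ × [0,∞)`, with the jet datum (4), «analytic solutions exist and do not blow up in time» (p.12);
Step 2 (§8 (15) pp.29–30): its slices are divergence-free for `t ≥ 0`; Step 3 (§9 (16)–(17) pp.31–32):
for every `ν > 0` the recipe (17) defines a smooth pressure, i.e. the residual is a gradient. The
explicit Maple field (12) is an image and is not transcribed; the ∃ over `u` is what the composition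
consumes. [cite: Muriel2010, §2–§4 pp.2–12; §8 (15) pp.29–30; §9 (16)–(17) pp.31–32] -/
def Step_123 : Prop :=
  ∃ (p₀ m : ℝ) (u : ℝ → R3 → R3), m ≠ 0 ∧
    -- Step 1: the TE field, smooth for t ≥ 0, with the uniform jet datum (4)
    IsSmoothOnHalfSpace u ∧ u 0 = jetDatum p₀ m ∧
    -- Step 2: (15) divergence-free slices
    (∀ t : ℝ, 0 ≤ t → NSWave0.IsDivFree (u t)) ∧
    -- Step 3: the recipe (16)–(17) defines a smooth pressure for every viscosity
    (∀ ν : ℝ, 0 < ν → ∃ P : ℝ → R3 → ℝ, IsSmoothOnHalfSpace P ∧ PressureRecipe ν u P)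

/-- **Step 1 alone** (§2–§4 pp.2–12): existence of the smooth TE field with the jet datum.
[cite: Muriel2010, §2–§4 pp.2–12, (12) p.11] -/
def Step_1_teField : Prop :=
  ∃ (p₀ m : ℝ) (u : ℝ → R3 → R3), m ≠ 0 ∧ IsSmoothOnHalfSpace u ∧ u 0 = jetDatum p₀ m

/-- **Step 2 as a property of a field** (§8 (15) pp.29–30): divergence-free slices for `t ≥ 0`
(«for most of the volume of the cube, the divergence is zero. At the boundaries, the condition no
longer holds», p.29). [cite: Muriel2010, (15) pp.29–30] -/
def Step_2_divFree (u : ℝ → R3 → R3) : Prop :=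
  ∀ t : ℝ, 0 ≤ t → NSWave0.IsDivFree (u t)

/-- **Step 3 as a property of a field** (§9 (16)–(17) pp.31–32): for every `ν > 0` the recipe yields a
smooth pressure. [cite: Muriel2010, (16)–(17) pp.31–32] -/
def Step_3_pressure (u : ℝ → R3 → R3) : Prop :=
  ∀ ν : ℝ, 0 < ν → ∃ P : ℝ → R3 → ℝ, IsSmoothOnHalfSpace P ∧ PressureRecipe ν u P

/-- **Step 3 at the ABSTRACT GRAIN (HYGIENE 13 companion)** — the recipe as a rule for velocity fields
in general: «Admittedly no one seems to write the Navier-Stokes Equation in the form of Eq. (16) …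
but we have all expressions for the velocities, and what we now do is evaluate the right-hand side of
NSE in Eq. (16) and find the gradient of the pressure» (p.31); «(17) which is simply NSE written in a
form that reflects the above-mentioned philosophical shift» (p.32); «The pressure itself in the
x-direction may be found by simply integrating the x-gradient of the pressure as calculated from NSE,
Eq. (17)» (p.36). Typed: for every `ν > 0` and every velocity field smooth on `ℝ³ × [0,∞)` with
divergence-free slices, some smooth `P` has `∇P = νΔu − (u·∇)u − ∂ₜu` — i.e. the residual is always a
gradient. [cite: Muriel2010, (16)–(17) pp.31–32; p.36] -/
def Step_3Abs : Prop :=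
  ∀ ν : ℝ, 0 < ν → ∀ u : ℝ → R3 → R3, IsSmoothOnHalfSpace u →
    (∀ t : ℝ, 0 ≤ t → NSWave0.IsDivFree (u t)) →
      ∃ P : ℝ → R3 → ℝ, IsSmoothOnHalfSpace P ∧ PressureRecipe ν u P

/-- **Step 4 — the printed bridge to the Clay problem** (abstract p.1 «All stipulations of the Clay
Mathematics Institute for proposed solutions of the 3-D Navier-Stokes Equation are satisfied by our
time evolution equation solution»; §1 p.2 «The Report is written to satisfy the requirements of the
Clay Institute of Mathematics»; §8 p.30 «The self-consistent non-linear solutions all satisfy the Clay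
stipulations, continuous fields and no blowup times»): the exhibited solution is asserted to answer the
Clay question, here (A). [cite: Muriel2010, abstract p.1; §1 p.2; §8 p.30] -/
def Step_4_bridge : Prop :=
  ClaimedTheorem → clayR3.Regularity

/-! ## Compositions and plumbing (pure logic / facts about this file's definitions) -/

/-- Steps 1–3 give the claimed exact solution: the momentum equation (1) is the recipe (17)
rearranged, (2) is Step 2, (3) is the datum clause. [cite: Muriel2010, §9 (16)–(17) pp.31–32, p.37] -/
theorem claim_of_steps (h : Step_123) : ClaimedTheorem := by
  obtain ⟨p₀, m, u, hm, hsm, h0, hdiv, hP⟩ := h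
  refine ⟨p₀, m, u, hm, hsm, h0, hdiv, fun ν hν => ?_⟩
  obtain ⟨P, hPs, hrec⟩ := hP ν hν
  refine ⟨P, hPs, hrec, ?_⟩
  exact
    { momentum := fun t ht x => by
        have h := hrec t ht x
        simp only [residual] at h
        rw [h]
        simp only [Pi.zero_apply, add_zero]
        abel
      divFree := hdiv
      initial := h0 }

/-- The Step-1/2/3 predicates assemble into `Step_123` (bookkeeping for a refuter who works with the
separate predicates). [cite: Muriel2010, §2–§9 pp.2–32] -/
theorem step123_of_parts {p₀ m : ℝ} {u : ℝ → R3 → R3} (hm : m ≠ 0) (hsm : IsSmoothOnHalfSpace u)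
    (h0 : u 0 = jetDatum p₀ m) (h2 : Step_2_divFree u) (h3 : Step_3_pressure u) : Step_123 :=
  ⟨p₀, m, u, hm, hsm, h0, h2, h3⟩

/-- The abstract-grain recipe implies the recipe for any particular smooth divergence-free field, in
particular for the Step-1 field. [cite: Muriel2010, (16)–(17) pp.31–32] -/
theorem step3_of_abs (h : Step_3Abs) {u : ℝ → R3 → R3} (hsm : IsSmoothOnHalfSpace u)
    (hdiv : Step_2_divFree u) : Step_3_pressure u :=
  fun ν hν => h ν hν u hsm hdiv

/-- Trivial use of the printed bridge. [cite: Muriel2010, abstract p.1] -/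
theorem clay_of_bridge (hb : Step_4_bridge) (h : ClaimedTheorem) : clayR3.Regularity :=
  hb h

/-- **Δ4 (kernel): the printed datum is not a Clay datum.** The uniform jet `u⁰ ≡ (p₀/m)eₓ` with
`p₀ ≠ 0`, `m ≠ 0` does not have rapid spatial decay (4) (it is a nonzero constant). [cite: Muriel2010, (4) p.3] -/
theorem jetDatum_not_clayData {p₀ m : ℝ} (hp : p₀ ≠ 0) (hm : m ≠ 0) :
    ¬ clayR3.data (jetDatum p₀ m) := by
  intro h
  -- (4) with n = 0, K = 1: (1 + ‖x‖) ‖u⁰ x‖ ≤ C for all x, impossible for a nonzero constant field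
  obtain ⟨C, hC⟩ := (h : HasRapidSpatialDecay (jetDatum p₀ m)) 0 1
  set c : R3 := (p₀ / m) • EuclideanSpace.single 0 1 with hc
  have hsingle : (EuclideanSpace.single (0 : Fin 3) (1 : ℝ)) ≠ 0 := by
    intro h0
    have := congrArg (fun v : R3 => v 0) h0
    simp at this
  have hcn : 0 < ‖c‖ := norm_pos_iff.mpr (smul_ne_zero (div_ne_zero hp hm) hsingle)
  -- evaluate at x = R • c with R large
  have key : ∀ x : R3, (1 + ‖x‖) * ‖c‖ ≤ C := by
    intro x
    have := hC x
    rwa [pow_one, norm_iteratedFDeriv_zero] at this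
  have h1 := key ((C / ‖c‖ ^ 2) • c)
  have hx : ‖(C / ‖c‖ ^ 2) • c‖ = |C| / ‖c‖ := by
    rw [norm_smul, Real.norm_eq_abs, abs_div, abs_of_pos (pow_pos hcn 2)]
    field_simp
  rw [hx] at h1
  have : (1 + |C| / ‖c‖) * ‖c‖ = ‖c‖ + |C| := by field_simp
  rw [this] at h1
  linarith [le_abs_self C]

/-! ## Rev 2 (ns-claims-typist-1 g2, additive): two kernel facts about the typed statement

The sentence-grain `ClaimedTheorem` / `Step_123` are ∃-statements about ONE datum; they HOLD for the
trivial reason that the uniform flow `u ≡ (p₀/m)eₓ`, `P ≡ 0` is an exact smooth solution of the unforced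
Navier–Stokes system (residual (16) `= 0 = ∇0`). Consequently the printed bridge `Step_4_bridge` is
EQUIVALENT to Clay (A) itself (cell ROUTE 5b; C109/C112/Wang2026 pattern): the exhibited solution
contributes nothing toward (A). Together with `jetDatum_not_clayData` (Δ4) these are the Δ-axis decls the
cell's wrong-problem schema asks for (lead RULING v1.29i). Nothing about the paper's Maple fields is
asserted. -/

/-- Unfolding `jetDatum` as a constant function. [cite: Muriel2010, (4) p.3] -/
theorem jetDatum_eq (p₀ m : ℝ) :
    jetDatum p₀ m = fun _ : R3 => (p₀ / m) • EuclideanSpace.single (0 : Fin 3) (1 : ℝ) := rfl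

/-- The NS residual (16) of the UNIFORM flow `u(t, x) ≡ u⁰` vanishes identically: `Δ const = 0`,
`(const·∇)const = 0`, `∂ₜ const = 0`. [cite: Muriel2010, (16) p.31; (4) p.3] -/
theorem residual_uniformFlow (ν p₀ m t : ℝ) (x : R3) :
    residual ν (fun _ : ℝ => jetDatum p₀ m) t x = 0 := by
  have h1 : derivWithin (fun _ : ℝ => jetDatum p₀ m x) (Ici 0) t = 0 := by simp
  have h2 : fderiv ℝ (jetDatum p₀ m) x = 0 := by
    rw [jetDatum_eq]; simp
  have h3 : (Δ (jetDatum p₀ m)) x = 0 := by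
    rw [InnerProductSpace.laplacian_eq_iteratedFDeriv_stdOrthonormalBasis, jetDatum_eq,
      iteratedFDeriv_const_of_ne (𝕜 := ℝ) (E := R3) two_ne_zero]
    simp
  simp only [residual, h1, h2, h3]
  simp

/-- **`Step_123` holds — witnessed by the uniform flow** (`p₀ = m = 1`, `u ≡ u⁰`, `P ≡ 0`): smooth,
datum (4), divergence-free slices, and the recipe (16)–(17) returns `∇0 = 0 =` residual. So the
∃-package the composition consumes is TRUE independently of the paper's construction.
[cite: Muriel2010, (4) p.3; (15) p.29; (16)–(17) pp.31–32] -/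
theorem step123_holds : Step_123 := by
  refine ⟨1, 1, fun _ => jetDatum 1 1, one_ne_zero, contDiffOn_const, rfl, fun t _ x => ?_,
    fun ν _ => ⟨fun _ _ => 0, contDiffOn_const, fun t _ x => ?_⟩⟩
  · rw [NSWave0.divergence, jetDatum_eq]
    simp
  · rw [residual_uniformFlow]
    simp [gradient]

/-- **`ClaimedTheorem` holds** (sentence grain: «an exact solution of the 3-D NSE for the uniform jet»)
— by the uniform flow, through the file's own composition. Δ6: the printed ∃-statement has no content
toward (A). [cite: Muriel2010, abstract p.1; §9 p.37; §12 p.38] -/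
theorem claimedTheorem_holds : ClaimedTheorem :=
  claim_of_steps step123_holds

/-- **The printed bridge IS Clay (A)**: `Step_4_bridge ↔ clayR3.Regularity` (cell ROUTE 5b — the
identification «Clay stipulations satisfied by our solution» carries the whole Millennium problem).
[cite: Muriel2010, abstract p.1; §1 p.2; §8 p.30] -/
theorem step4_bridge_iff_clayA : Step_4_bridge ↔ clayR3.Regularity :=
  ⟨fun h => h claimedTheorem_holds, fun h _ => h⟩



/-- **`Step_1_teField` holds** (APPEND-ONLY, 2026-08-27, ns-claims typist-8 g5, D-0026 debt pass): the bare
Step-1 existential (§2–§4 pp.2–12: a field smooth on `ℝ³ × [0,∞)` with the uniform jet datum (4), `m ≠ 0`)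
is the projection of `step123_holds` (the uniform flow). Record only; #85's token/locator (`Step_3Abs`, refuted
Summits-side) untouched. [cite: Muriel2010, §2–§4 pp.2–12, (12) p.11] -/
theorem step_1_teField_holds : Step_1_teField := by
  obtain ⟨p₀, m, u, hm, hsm, h0, -, -⟩ := step123_holds
  exact ⟨p₀, m, u, hm, hsm, h0⟩

/-- `Step_1_teField` — `_holds` alias of `step_1_teField_holds` above under the fact's exact name (appended
2026-08-28, D-0026 bookkeeping: the proof term is the existing theorem of this file; no statement,
definition or attribute is edited; no new named fact; the ledger's debt table listed the fact
unproved). [cite: Muriel2010, §2–§4 pp.2–12, (12) p.11] -/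
theorem _root_.Literature.Claims.NS.Muriel2010.Step_1_teField_holds : Step_1_teField :=
  _root_.Literature.Claims.NS.Muriel2010.step_1_teField_holds

end

end Literature.Claims.NS.Muriel2010
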